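import Literature.Barriers.CriticalPhenomena.PlaquetteWalkHoleRootRowOnly
import HarnessLib

/-!
# Barrier catalogue (SAWScalingLimit): in the HOLE COLUMN the straight level-`7` class-`B2a` member returns to its rhombus FROM THE FAR SIDE, down (or up) a straight wall
from the extreme row («HOLE COLUMN: THE STRAIGHT MEMBER RETURNS FROM THE FAR SIDE»)

`Z → ∞` limit model of the printed Yang–Baxter weights [GlazmanManolescu2019, §1, eq. (1)]; the «RECTANGLE COEFFICIENT» line (b-engine-1 g28), second structural step of
the HOLE-COLUMN programme (FINDING-YB-HOLE-COLUMN-FOUR-PHASE; DESIGN-next b-engine-1 g28 §4–§5, kind (a)). By `PlaquetteWalkHoleRootHoleColumnSeven` a cost-`7`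
slanted-end wound class-`B2a` walk at a hole-column rhombus `r = (w.1 − 1, r.2)` crosses `r` straight; here, for `r` strictly above the hole and strictly below the
walk's top row (and, by the reflection `ω.mirrorAt` in the root row [GlazmanManolescu2019, §4.2], for `r` strictly below the hole and strictly above the bottom row):

* ★★★ `ΩG.descent_of_cost_seven_straight_holeColumn_above`: the arc of `r` is horizontal, the seven isolated turns are the two top-row turns, the two bottom-row turns, the
  root-row turn `τ` and the two ends `e_W`, `e_E` of the horizontal chains of `r`; hence the end is `N` (a return from below would need an eighth turn: the last plaquette
  or the end of its chain towards the hole, which cannot reach the bottom row through the absent hole), the last plaquette `L = (r.1, r.2 + 1)` is left through `S` and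
  entered from `N`, and the last `Y − r.2` arcs DESCEND the hole column from the top row `Y` straight into `r` (no plaquette of a middle row above `r` uses `W`: its west
  chain would end at an eighth turn).
* ★★★ `ΩG.descent_of_cost_seven_straight_holeColumn_below`: the mirror statement below the hole (end `S`, last plaquette `(r.1, r.2 − 1)` left through `N`, a straight
  ASCENT of the hole column from the bottom row).
* ★★ `ΩG.descent_of_cost_seven_straight_holeColumn`: both sides at once (the side is decided by the sign of `r.2 − w.2`).

[GlazmanManolescu2019 §1 Fig. 1, eq. (1), Lemma 2.1, Remark 2.2, §4.2; Glazman2015WeightedSAW Lemma 3.1 (proof, pp. 6–7); CourantRobbins1958 Ch. V App. §2]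
-/

noncomputable section

namespace Literature.Probability.RandomPlanarGeometry.SAW.YangBaxter

open Real
open Literature.Barriers.CriticalPhenomena.PlaquetteWalk

open private fc_fh fh_add_Mv three_le_Mv from Literature.Probability.RandomPlanarGeometry.YangBaxterSAWGeneralDomain

namespace ΩG

variable {D : Set Face} {w r : Face} {ω : ΩG D (w.side .W) r}

/-- ★★★ **HOLE COLUMN: THE STRAIGHT LEVEL-`7` MEMBER RETURNS FROM ABOVE.** Let `ω` be a wound class-`B2a` walk of limit cost `7` from the hole root `w.side W` (hole
`(w.1 − 1, w.2)` absent) with a slanted end and a STRAIGHT first arc at a rhombus `r` of the hole column (`r.1 = w.1 − 1`) strictly above the hole, some arc of `ω` lying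
strictly above the row of `r`. Then `ω.1 = N`, the last plaquette is `(r.1, r.2 + 1)`, left through `S`, and for the walk's top row `Y` the last `Y − r.2` arcs lie at
`(r.1, Y), (r.1, Y − 1), …, (r.1, r.2 + 1)`, all but the first entered from `N`. [cite: GlazmanManolescu2019, §1, Fig. 1 and eq. (1); Lemma 2.1; Remark 2.2]
[cite: Glazman2015WeightedSAW, Lemma 3.1 (proof, pp. 6–7)] [cite: CourantRobbins1958, Ch. V Appendix §2 (the even–odd rule)] -/
theorem descent_of_cost_seven_straight_holeColumn_above (hh : holeFaceW w ∉ D) (hr : RootedFace D (w.side .W) r) (h : ω.IsB2a)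
    (hA : ω.AJ hr h (toC (midPt (w.side .W))) ≠ 0) (hc : cost (slotOfSide ω.1) ω.2.mids = 7) (hz : ω.1 = .N ∨ ω.1 = .S)
    (hstr8 : arcKind (ω.2.sIn ω.2.firstHitG) (ω.2.sOut ω.2.firstHitG) = .straight) (hcol : r.1 = w.1 - 1) (habove : w.2 < r.2)
    (hup : ∃ j < ω.2.arcs.length, r.2 < (ω.2.fc j).2) :
    ω.1 = .N ∧ ω.2.fc (ω.2.arcs.length - 1) = (r.1, r.2 + 1) ∧ ω.2.sOut (ω.2.arcs.length - 1) = .S ∧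
      ∃ Y : ℤ, (∀ j < ω.2.arcs.length, (ω.2.fc j).2 ≤ Y) ∧ r.2 < Y ∧
        (∀ m : ℕ, (m : ℤ) ≤ Y - r.2 - 1 → ω.2.fc (ω.2.arcs.length - 1 - m) = (r.1, r.2 + 1 + m)) ∧
        (∀ m : ℕ, (m : ℤ) < Y - r.2 - 1 → ω.2.sIn (ω.2.arcs.length - 1 - m) = .N) := by
  classical
  set n := ω.2.arcs.length with hn
  ---------------------------------------------------------------- basics
  have hF := ω.fh_lt h
  have hlen : 0 < n := by omega
  have h0w : ω.2.fc 0 = w := fc_zero_eq_root w hh ω.2 hlen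
  have h0W : ω.2.sIn 0 = .W := YBWalk.sIn_zero_eq_W hh ω.2 hlen
  have h0E : ω.2.sIn 0 ≠ .E := by rw [h0W]; decide
  have h0N : ω.2.sIn 0 ≠ .N := by rw [h0W]; decide
  have h0S : ω.2.sIn 0 ≠ .S := by rw [h0W]; decide
  have hfcF := (fc_fh ω hr h).1
  have hsvr : ∀ l < n, ω.2.fc l = ω.2.fc ω.2.firstHitG → l = ω.2.firstHitG := fun l hl e => eq_firstHitG_of_fc_eq hr h hl e
  have hfne3 : ω.2.firstHitG + 3 ≤ n := by have := three_le_Mv hr h; have := fh_add_Mv h; unfold ΩG.Mv at *; omega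
  have hn1 : n - 1 < n := by omega
  have hlast := sOut_last_NS_of_slanted h hz
  have hzE : ω.2.sOut (n - 1) ≠ .E := by rcases hlast with e | e <;> rw [e] <;> decide
  have hzW : ω.2.sOut (n - 1) ≠ .W := by rcases hlast with e | e <;> rw [e] <;> decide
  have hlastr := fc_last_ne_root hr h
  have hLD : ω.2.fc (n - 1) ∈ D := (YBWalk.arcFace_arcAt hn1).2
  have hmemD : ∀ {c : Face} {s : Side}, ω.2.UsesSide c s → c ∈ D := by
    intro c s hu
    obtain ⟨j, hj, hfj⟩ := ω.2.exists_fc_eq_of_usesSide hu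
    rw [← hfj]; exact (YBWalk.arcFace_arcAt hj).2
  have hnotD : ∀ {c : Face}, c ∈ D → c = holeFaceW w → False := fun hc e => hh (e ▸ hc)
  have hzside : (ω.2.fc (n - 1)).side (ω.2.sOut (n - 1)) = r.side ω.1 := by
    obtain ⟨-, hout⟩ := ω.2.side_sIn_eq_nth hn1
    rwa [show n - 1 + 1 = n by omega, ω.2.nth_length] at hout
  -- the side of `r` carrying the end is not used by the arc of `r`
  have hrside : ∀ s, ω.2.UsesSide r s → r.side s ≠ r.side ω.1 := by
    rintro s ⟨l, hl, hfl, hs⟩ e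
    have hl' := hsvr l hl (hfl.trans hfcF.symm)
    obtain ⟨hin, hout⟩ := ω.2.side_sIn_eq_nth hl
    rw [hfl] at hin hout
    rw [← ω.2.nth_length] at e
    rcases hs with hs | hs
    · rw [hs] at hin; have := ω.2.nth_inj (show l ≤ n by omega) le_rfl (hin.symm.trans e).symm.symm; omega
    · rw [hs] at hout; have := ω.2.nth_inj (show l + 1 ≤ n by omega) le_rfl (hout.symm.trans e).symm.symm; omega
  -- the last plaquette: `ω.1 = N`: `L = (r.1, r.2 + 1)`, left through `S`; `ω.1 = S`: `L = (r.1, r.2 − 1)`, left through `N`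
  have hLcases : (ω.1 = .N ∧ ω.2.sOut (n - 1) = .S ∧ ω.2.fc (n - 1) = (r.1, r.2 + 1)) ∨
      (ω.1 = .S ∧ ω.2.sOut (n - 1) = .N ∧ ω.2.fc (n - 1) = (r.1, r.2 - 1)) := by
    rcases hfc : ω.2.fc (n - 1) with ⟨x, y⟩
    rw [hfc] at hzside hlastr
    rcases r with ⟨r1, r2⟩
    simp only at hlastr ⊢
    generalize hs : ω.2.sOut (n - 1) = s at hzside hlast ⊢
    generalize ht : ω.1 = t at hzside hz ⊢
    rcases hz with rfl | rfl <;> rcases hlast with rfl | rfl <;>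
      simp only [Face.side, MidEdge.slant.injEq, Prod.mk.injEq, reduceCtorEq, false_and, and_false, true_and, false_or, or_false] at hzside ⊢
    · exact absurd (Prod.ext hzside.1 (by simp only; omega)) hlastr
    · refine ⟨?_, ?_⟩ <;> omega
    · refine ⟨?_, ?_⟩ <;> omega
    · exact absurd (Prod.ext hzside.1 (by simp only; omega)) hlastr
  ---------------------------------------------------------------- isolated turns: seven, as `P`-cells
  have h7 : cfgCount ω.2.mids [.corner] + cfgCount ω.2.mids [.coCorner] = 7 := by
    have hcost : cost (slotOfSide ω.1) ω.2.mids =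
        cfgCount ω.2.mids [.corner] + cfgCount ω.2.mids [.coCorner] + (1 - slotDeg (slotOfSide ω.1)) := rfl
    have hd : slotDeg (slotOfSide ω.1) = 1 := by rcases hz with e | e <;> rw [e] <;> rfl
    rw [hcost, hd] at hc; omega
  let P : Face → Prop := fun f => f ∈ facesL ω.2.mids ∧ (kindsL ω.2.mids f = [.corner] ∨ kindsL ω.2.mids f = [.coCorner])
  have hPiso : ∀ k < n, (∀ l < n, ω.2.fc l = ω.2.fc k → l = k) → arcKind (ω.2.sIn k) (ω.2.sOut k) ≠ .straight → P (ω.2.fc k) :=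
    fun k hk hsv hkind => isolated_turn hk hsv hkind
  have hle7 : ∀ T : Finset Face, (∀ f ∈ T, P f) → T.card ≤ 7 := by
    intro T hT; have := YBWalk.card_le_cfgCount_add ω.2.mids T hT; omega
  -- top and bottom turns
  obtain ⟨Y, hYw, hY, Tt, hTtP, hTtrow, hTtcard⟩ := two_top_turns hh hr h hA
  have hTt2 : 1 < Tt.card := by
    rcases hTtcard with h2 | ⟨-, hzv, -⟩
    · omega
    · exfalso; rcases hz with e | e <;> rcases hzv with e' | e' <;> rw [e] at e' <;> exact absurd e' (by decide)
  obtain ⟨t₁, ht₁, t₂, ht₂, ht12⟩ := Finset.one_lt_card.1 hTt2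
  have hPt₁ : P t₁ := hTtP t₁ ht₁
  have hPt₂ : P t₂ := hTtP t₂ ht₂
  have ht₁row : t₁.2 = Y := hTtrow t₁ ht₁
  have ht₂row : t₂.2 = Y := hTtrow t₂ ht₂
  obtain ⟨Y', hY'w, hY', Tb, hTbP, hTbrow, hTbcard⟩ := two_bottom_turns hh hr h hA
  have hTb2 : 1 < Tb.card := by
    rcases hTbcard with h2 | ⟨-, hzv, -⟩
    · omega
    · exfalso; rcases hz with e | e <;> rcases hzv with e' | e' <;> rw [e] at e' <;> exact absurd e' (by decide)
  obtain ⟨b₁, hb₁, b₂, hb₂, hb12⟩ := Finset.one_lt_card.1 hTb2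
  have hPb₁ : P b₁ := hTbP b₁ hb₁
  have hPb₂ : P b₂ := hTbP b₂ hb₂
  have hb₁row : b₁.2 = Y' := hTbrow b₁ hb₁
  have hb₂row : b₂.2 = Y' := hTbrow b₂ hb₂
  have hNtop := forall_top_ne_N hh hr h hY (by omega)
  obtain ⟨X', -, hX', -⟩ := exists_right_entry_turn hh hr h
  obtain ⟨X, hXw, hX, -⟩ := exists_left_entry_turn hh hr h hA
  have hrY : r.2 ≤ Y := by have := hY _ hF; rwa [hfcF] at this
  ---------------------------------------------------------------- the first turn and the root-row turn `τ = (τ1, w.2)`, `τ1 ≥ w.1`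
  have hexk : ∃ k, k < n ∧ arcKind (ω.2.sIn k) (ω.2.sOut k) ≠ .straight := by
    by_contra hnone
    push Not at hnone
    obtain ⟨hrun0, -⟩ := ω.2.initial_run hh hF (fun i hi => hnone i (by omega))
    have e := (hrun0 ω.2.firstHitG le_rfl).1
    rw [hfcF] at e
    have := congrArg Prod.snd e; simp only at this; omega
  obtain ⟨hk₁, -⟩ := Nat.find_spec hexk
  set k₁ := Nat.find hexk with hk₁def
  have hstr : ∀ i < k₁, arcKind (ω.2.sIn i) (ω.2.sOut i) = .straight := by
    intro i hi; by_contra hne; exact Nat.find_min hexk hi ⟨by omega, hne⟩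
  obtain ⟨hrun, -⟩ := ω.2.initial_run hh hk₁ hstr
  obtain ⟨hfk, hWk⟩ := hrun k₁ le_rfl
  have hp₁W : ω.2.UsesSide (w.1 + k₁, w.2) .W := ⟨k₁, hk₁, hfk, Or.inl hWk⟩
  obtain ⟨τ1, hPτ, hτ1w⟩ : ∃ τ1 : ℤ, P (τ1, w.2) ∧ w.1 + k₁ ≤ τ1 := by
    by_cases hpE : ω.2.UsesSide (w.1 + k₁, w.2) .E
    · obtain ⟨M, hWall, -, hend⟩ := ω.2.chain_E hX' hpE
      rcases hend with ⟨hM1, hnot⟩ | ⟨-, hs0⟩ | ⟨-, hsZ⟩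
      · obtain ⟨i', hi', hfc', hsv', -, -, -, hk'⟩ := ω.2.isolated_of_usesSide_not_opp (hWall M hM1 le_rfl) hnot
        refine ⟨w.1 + k₁ + M, ?_, by omega⟩
        have := hPiso i' hi' hsv' hk'; rw [hfc'] at this; exact this
      · exact absurd hs0 h0E
      · exact absurd hsZ hzE
    · obtain ⟨i', hi', hfc', hsv', -, -, -, hk'⟩ := ω.2.isolated_of_usesSide_not_opp hp₁W hpE
      refine ⟨w.1 + k₁, ?_, le_rfl⟩
      have := hPiso i' hi' hsv' hk'; rw [hfc'] at this; exact this
  -- `r` is not in the top row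
  have hrtop : r.2 ≠ Y := by
    obtain ⟨j, hj, hjr⟩ := hup
    have := hY j hj
    omega
  have hr₂ : Y' < r.2 := by omega
  have hr₃ : r.2 < Y := lt_of_le_of_ne hrY hrtop
  ---------------------------------------------------------------- the arc of `r` is horizontal: `r` uses `W` and `E`; the ends `e_W`, `e_E` of its chains are isolated turns on the row of `r`
  have hrWE : ω.2.UsesSide r .W ∧ ω.2.UsesSide r .E := by
    have hne := ω.2.sIn_ne_sOut hF
    have hnoz : ¬(ω.2.sIn ω.2.firstHitG = ω.1 ∨ ω.2.sOut ω.2.firstHitG = ω.1) := fun hs => hrside ω.1 ⟨_, hF, hfcF, hs⟩ rfl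
    have key : ∀ t : Side, (t = .N ∨ t = .S) → ¬(ω.2.sIn ω.2.firstHitG = t ∨ ω.2.sOut ω.2.firstHitG = t) →
        arcKind (ω.2.sIn ω.2.firstHitG) (ω.2.sOut ω.2.firstHitG) = .straight → ω.2.sIn ω.2.firstHitG ≠ ω.2.sOut ω.2.firstHitG →
        (ω.2.sIn ω.2.firstHitG = .W ∨ ω.2.sOut ω.2.firstHitG = .W) ∧ (ω.2.sIn ω.2.firstHitG = .E ∨ ω.2.sOut ω.2.firstHitG = .E) := by
      intro t ht
      cases ω.2.sIn ω.2.firstHitG <;> cases ω.2.sOut ω.2.firstHitG <;> rcases ht with rfl | rfl <;> decide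
    obtain ⟨hW, hE⟩ := key ω.1 hz hnoz hstr8 hne
    exact ⟨⟨_, hF, hfcF, hW⟩, ⟨_, hF, hfcF, hE⟩⟩
  obtain ⟨hrW, hrE⟩ := hrWE
  obtain ⟨MW, hEW, -, hendW⟩ := ω.2.chain_W hX hrW
  obtain ⟨hMW1, hPeW⟩ : 1 ≤ MW ∧ P (r.1 - MW, r.2) := by
    rcases hendW with ⟨hM1, hnot⟩ | ⟨hA0, -⟩ | ⟨-, hsZ⟩
    · obtain ⟨i', hi', hfc', hsv', -, -, -, hk'⟩ := ω.2.isolated_of_usesSide_not_opp (hEW MW hM1 le_rfl) hnot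
      refine ⟨hM1, ?_⟩
      have := hPiso i' hi' hsv' hk'; rw [hfc'] at this; exact this
    · exfalso; rw [h0w] at hA0; have := congrArg Prod.snd hA0; simp only at this; omega
    · exact absurd hsZ hzW
  obtain ⟨ME, hWE, -, hendE⟩ := ω.2.chain_E hX' hrE
  obtain ⟨hME1, hPeE⟩ : 1 ≤ ME ∧ P (r.1 + ME, r.2) := by
    rcases hendE with ⟨hM1, hnot⟩ | ⟨-, hs0⟩ | ⟨-, hsZ⟩
    · obtain ⟨i', hi', hfc', hsv', -, -, -, hk'⟩ := ω.2.isolated_of_usesSide_not_opp (hWE ME hM1 le_rfl) hnot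
      refine ⟨hM1, ?_⟩
      have := hPiso i' hi' hsv' hk'; rw [hfc'] at this; exact this
    · exact absurd hs0 h0E
    · exact absurd hsZ hzE
  ---------------------------------------------------------------- an eighth isolated turn strictly between the extreme rows, off the root row and off the row of `r`, is impossible
  have hne_of_row : ∀ f g : Face, f.2 ≠ g.2 → f ≠ g := fun f g hfg e => hfg (by rw [e])
  have houts1 : ∀ g : Face, P g → Y' < g.2 → g.2 < Y → g.2 ≠ w.2 → g.2 ≠ r.2 → False := by
    intro g hPg a1 a2 a3 a4
    have n1 : g ≠ t₁ := hne_of_row _ _ (by rw [ht₁row]; omega)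
    have n2 : g ≠ t₂ := hne_of_row _ _ (by rw [ht₂row]; omega)
    have n3 : g ≠ b₁ := hne_of_row _ _ (by rw [hb₁row]; omega)
    have n4 : g ≠ b₂ := hne_of_row _ _ (by rw [hb₂row]; omega)
    have n5 : g ≠ ((τ1 : ℤ), w.2) := hne_of_row _ _ (by simp only; exact a3)
    have n6 : g ≠ ((r.1 : ℤ) - MW, r.2) := hne_of_row _ _ (by simp only; exact a4)
    have n7 : g ≠ ((r.1 : ℤ) + ME, r.2) := hne_of_row _ _ (by simp only; exact a4)
    have h01 : t₁ ≠ t₂ := ht12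
    have h02 : t₁ ≠ b₁ := hne_of_row _ _ (by rw [ht₁row, hb₁row]; omega)
    have h03 : t₁ ≠ b₂ := hne_of_row _ _ (by rw [ht₁row, hb₂row]; omega)
    have h04 : t₁ ≠ ((τ1 : ℤ), w.2) := hne_of_row _ _ (by rw [ht₁row]; simp only; omega)
    have h05 : t₁ ≠ ((r.1 : ℤ) - MW, r.2) := hne_of_row _ _ (by rw [ht₁row]; simp only; omega)
    have h06 : t₁ ≠ ((r.1 : ℤ) + ME, r.2) := hne_of_row _ _ (by rw [ht₁row]; simp only; omega)
    have h12 : t₂ ≠ b₁ := hne_of_row _ _ (by rw [ht₂row, hb₁row]; omega)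
    have h13 : t₂ ≠ b₂ := hne_of_row _ _ (by rw [ht₂row, hb₂row]; omega)
    have h14 : t₂ ≠ ((τ1 : ℤ), w.2) := hne_of_row _ _ (by rw [ht₂row]; simp only; omega)
    have h15 : t₂ ≠ ((r.1 : ℤ) - MW, r.2) := hne_of_row _ _ (by rw [ht₂row]; simp only; omega)
    have h16 : t₂ ≠ ((r.1 : ℤ) + ME, r.2) := hne_of_row _ _ (by rw [ht₂row]; simp only; omega)
    have h23 : b₁ ≠ b₂ := hb12
    have h24 : b₁ ≠ ((τ1 : ℤ), w.2) := hne_of_row _ _ (by rw [hb₁row]; simp only; omega)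
    have h25 : b₁ ≠ ((r.1 : ℤ) - MW, r.2) := hne_of_row _ _ (by rw [hb₁row]; simp only; omega)
    have h26 : b₁ ≠ ((r.1 : ℤ) + ME, r.2) := hne_of_row _ _ (by rw [hb₁row]; simp only; omega)
    have h34 : b₂ ≠ ((τ1 : ℤ), w.2) := hne_of_row _ _ (by rw [hb₂row]; simp only; omega)
    have h35 : b₂ ≠ ((r.1 : ℤ) - MW, r.2) := hne_of_row _ _ (by rw [hb₂row]; simp only; omega)
    have h36 : b₂ ≠ ((r.1 : ℤ) + ME, r.2) := hne_of_row _ _ (by rw [hb₂row]; simp only; omega)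
    have h45 : ((τ1 : ℤ), w.2) ≠ ((r.1 : ℤ) - MW, r.2) := hne_of_row _ _ (by simp only; omega)
    have h46 : ((τ1 : ℤ), w.2) ≠ ((r.1 : ℤ) + ME, r.2) := hne_of_row _ _ (by simp only; omega)
    have h56 : ((r.1 : ℤ) - MW, r.2) ≠ ((r.1 : ℤ) + ME, r.2) := by intro e; have := congrArg Prod.fst e; simp only at this; omega
    have hT : ∀ f ∈ ({g, t₁, t₂, b₁, b₂, ((τ1 : ℤ), w.2), ((r.1 : ℤ) - MW, r.2), ((r.1 : ℤ) + ME, r.2)} : Finset Face), P f := by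
      intro f hf
      simp only [Finset.mem_insert, Finset.mem_singleton] at hf
      rcases hf with rfl | rfl | rfl | rfl | rfl | rfl | rfl | rfl
      exacts [hPg, hPt₁, hPt₂, hPb₁, hPb₂, hPτ, hPeW, hPeE]
    have hcard : ({g, t₁, t₂, b₁, b₂, ((τ1 : ℤ), w.2), ((r.1 : ℤ) - MW, r.2), ((r.1 : ℤ) + ME, r.2)} : Finset Face).card = 8 := by
      rw [Finset.card_insert_of_notMem (by simp only [Finset.mem_insert, Finset.mem_singleton, not_or]; exact ⟨n1, n2, n3, n4, n5, n6, n7⟩),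
        Finset.card_insert_of_notMem (by simp only [Finset.mem_insert, Finset.mem_singleton, not_or]; exact ⟨h01, h02, h03, h04, h05, h06⟩),
        Finset.card_insert_of_notMem (by simp only [Finset.mem_insert, Finset.mem_singleton, not_or]; exact ⟨h12, h13, h14, h15, h16⟩),
        Finset.card_insert_of_notMem (by simp only [Finset.mem_insert, Finset.mem_singleton, not_or]; exact ⟨h23, h24, h25, h26⟩),
        Finset.card_insert_of_notMem (by simp only [Finset.mem_insert, Finset.mem_singleton, not_or]; exact ⟨h34, h35, h36⟩),
        Finset.card_insert_of_notMem (by simp only [Finset.mem_insert, Finset.mem_singleton, not_or]; exact ⟨h45, h46⟩),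
        Finset.card_insert_of_notMem (by simp only [Finset.mem_singleton]; exact h56), Finset.card_singleton]
    have := hle7 _ hT
    omega
  -- a vertical chain in the hole column, from a plaquette strictly above the hole downwards, ends strictly above the hole (the hole is in the way)
  have hSchain : ∀ c : Face, c.1 = w.1 - 1 → w.2 < c.2 → c.2 ≤ r.2 → ω.2.UsesSide c .S →
      (c = ω.2.fc (n - 1) → ω.2.sOut (n - 1) ≠ .S) → ∃ e₂ : Face, P e₂ ∧ w.2 < e₂.2 ∧ e₂.2 < c.2 := by
    intro c hc1 hc2 hcr hcS hcL
    obtain ⟨M, hNall, -, hend⟩ := ω.2.chain_S hY' hcS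
    rcases hend with ⟨hM1, hnot⟩ | ⟨-, hs0⟩ | ⟨hZ, hsZ⟩
    · obtain ⟨i', hi', hfc', hsv', -, -, -, hk'⟩ := ω.2.isolated_of_usesSide_not_opp (hNall M hM1 le_rfl) hnot
      have hP' : P (c.1, c.2 - M) := by rw [← hfc']; exact hPiso i' hi' hsv' hk'
      have habove' : w.2 < c.2 - M := by
        by_contra hle
        push Not at hle
        obtain ⟨mh, hmh⟩ : ∃ mh : ℕ, (mh : ℤ) = c.2 - w.2 := ⟨(c.2 - w.2).toNat, by omega⟩
        have huse := hNall mh (by omega) (by omega)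
        exact hnotD (hmemD huse) (Prod.ext (by simp only [holeFaceW]; omega) (by simp only [holeFaceW]; omega))
      exact ⟨_, hP', habove', by simp only; omega⟩
    · exact absurd hs0 h0S
    · exfalso
      by_cases hM0 : M = 0
      · subst hM0
        have e : c = ω.2.fc (n - 1) := by rw [← hZ]; simp
        exact hcL e hsZ
      · rcases hLcases with ⟨-, -, hL⟩ | ⟨-, hsN, -⟩
        · rw [hL] at hZ; have := congrArg Prod.snd hZ; simp only at this; omega
        · rw [hsN] at hsZ; exact absurd hsZ (by decide)
  ---------------------------------------------------------------- the end is `N`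
  have hωN : ω.1 = .N := by
    rcases hLcases with ⟨hωN, -, -⟩ | ⟨hωS, hsN, hL⟩
    · exact hωN
    · exfalso
      -- `L = (r.1, r.2 − 1)` strictly above the hole; it uses `S` or is an eighth isolated turn
      have hL2 : w.2 < r.2 - 1 := by
        by_contra hle
        exact hnotD hLD (by rw [hL]; exact Prod.ext (by simp only [holeFaceW]; omega) (by simp only [holeFaceW]; omega))
      by_cases hLS : ω.2.UsesSide (ω.2.fc (n - 1)) .S
      · obtain ⟨e₂, hPe₂, he₂lo, he₂hi⟩ :=
          hSchain (ω.2.fc (n - 1)) (by rw [hL]; exact hcol) (by rw [hL]; exact hL2) (by rw [hL]; simp only; omega) hLS (fun _ => by rw [hsN]; decide)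
        rw [hL] at he₂hi; simp only at he₂hi
        exact houts1 e₂ hPe₂ (by omega) (by omega) (by omega) (by omega)
      · have hsvL : ∀ j < n, ω.2.fc j = ω.2.fc (n - 1) → j = n - 1 := by
          intro j hj e
          by_contra hne
          exact hLS (by have := ω.2.usesSide_of_fc_eq hj hn1 hne e .S; rwa [e] at this)
        have hkL : arcKind (ω.2.sIn (n - 1)) (ω.2.sOut (n - 1)) ≠ .straight := by
          have hne := ω.2.sIn_ne_sOut hn1
          have hnS : ω.2.sIn (n - 1) ≠ .S := fun e => hLS ⟨_, hn1, rfl, Or.inl e⟩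
          revert hne hnS; rw [hsN]; cases ω.2.sIn (n - 1) <;> decide
        have hPL : P (ω.2.fc (n - 1)) := hPiso _ hn1 hsvL hkL
        rw [hL] at hPL
        exact houts1 _ hPL (by simp only; omega) (by simp only; omega) (by simp only; omega) (by simp only; omega)
  obtain ⟨-, hsS, hL⟩ : ω.1 = .N ∧ ω.2.sOut (n - 1) = .S ∧ ω.2.fc (n - 1) = (r.1, r.2 + 1) := by
    rcases hLcases with hcase | ⟨hωS, -, -⟩
    · exact hcase
    · rw [hωN] at hωS; exact absurd hωS (by decide)
  refine ⟨hωN, hL, hsS, Y, hY, hr₃, ?_⟩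
  ---------------------------------------------------------------- the column above `L` is a straight singly visited wall up to the top row
  -- no plaquette of a middle row above the row of `r` uses `W`
  have hWabove : ∀ c : Face, r.2 < c.2 → c.2 < Y → ¬ω.2.UsesSide c .W := by
    intro c h1 h2 hcW
    obtain ⟨M, hEall, -, hend⟩ := ω.2.chain_W hX hcW
    rcases hend with ⟨hM1, hnot⟩ | ⟨hA0, -⟩ | ⟨-, hsZ⟩
    · obtain ⟨i', hi', hfc', hsv', -, -, -, hk'⟩ := ω.2.isolated_of_usesSide_not_opp (hEall M hM1 le_rfl) hnot
      have hP' : P (c.1 - M, c.2) := by rw [← hfc']; exact hPiso i' hi' hsv' hk'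
      exact houts1 _ hP' (by simp only; omega) (by simp only; omega) (by simp only; omega) (by simp only; omega)
    · rw [h0w] at hA0; have := congrArg Prod.snd hA0; simp only at this; omega
    · rw [hsS] at hsZ; exact absurd hsZ (by decide)
  -- hence such plaquettes are singly visited
  have hsvabove : ∀ i < n, r.2 < (ω.2.fc i).2 → (ω.2.fc i).2 < Y → ∀ j < n, ω.2.fc j = ω.2.fc i → j = i := by
    intro i hi h1 h2 j hj e
    by_contra hne
    exact hWabove _ h1 h2 (ω.2.usesSide_of_fc_eq hi hj (Ne.symm hne) e.symm .W)
  -- `L` uses `N` unless it is the top turn itself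
  by_cases hLtop : r.2 + 1 = Y
  · -- the descent has length zero
    refine ⟨fun m hm => ?_, fun m hm => by omega⟩
    have hm0 : m = 0 := by omega
    subst hm0; simpa using hL
  have hLlt : r.2 + 1 < Y := by have := hY _ hn1; rw [hL] at this; simp only at this; omega
  have hLN : ω.2.UsesSide (r.1, r.2 + 1) .N := by
    have hne := ω.2.sIn_ne_sOut hn1
    rw [hsS] at hne
    by_cases hN : ω.2.sIn (n - 1) = .N
    · exact ⟨_, hn1, hL, Or.inl hN⟩
    · -- a turning last arc: `L` is singly visited (no `W` on its row), hence an eighth isolated turn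
      exfalso
      have hk : arcKind (ω.2.sIn (n - 1)) (ω.2.sOut (n - 1)) ≠ .straight := by
        revert hne hN; rw [hsS]; cases ω.2.sIn (n - 1) <;> decide
      have hsv := hsvabove (n - 1) hn1 (by rw [hL]; simp only; omega) (by rw [hL]; simp only; omega)
      have hPL := hPiso _ hn1 hsv hk
      rw [hL] at hPL
      exact houts1 _ hPL (by simp only; omega) (by simp only; omega) (by simp only; omega) (by simp only; omega)
  -- the north chain of `L` ends at the top row
  obtain ⟨Mt, hSall, hNall', hendt⟩ := ω.2.chain_N hY hLN
  have hMt : (Mt : ℤ) = Y - r.2 - 1 := by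
    rcases hendt with ⟨hM1, hnot⟩ | ⟨-, hs0⟩ | ⟨hZ, hsZ⟩
    · obtain ⟨i', hi', hfc', hsv', -, -, -, hk'⟩ := ω.2.isolated_of_usesSide_not_opp (hSall Mt hM1 le_rfl) hnot
      have hP' : P (r.1, r.2 + 1 + Mt) := by rw [← hfc']; exact hPiso i' hi' hsv' hk'
      have hle : r.2 + 1 + Mt ≤ Y := by have := hY i' hi'; rw [hfc'] at this; exact this
      rcases lt_or_eq_of_le hle with hlt | heq
      · exfalso; exact houts1 _ hP' (by simp only; omega) (by simp only; omega) (by simp only; omega) (by simp only; omega)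
      · omega
    · exact absurd hs0 h0N
    · exfalso; rw [hsS] at hsZ; exact absurd hsZ (by decide)
  -- the cells of the wall are straight: they use `N` and `S` and are singly visited
  have hwall : ∀ m : ℕ, 1 ≤ m → m < Mt → ∀ i < n, ω.2.fc i = (r.1, r.2 + 1 + m) →
      arcKind (ω.2.sIn i) (ω.2.sOut i) = .straight := by
    intro m hm1 hmM i hi hfi
    have hsv := hsvabove i hi (by rw [hfi]; simp only; omega) (by rw [hfi]; simp only; omega)
    have hS := hSall m hm1 hmM.le
    have hN := hNall' m hmM
    simp only at hS hN
    obtain ⟨j, hj, hfj, hjS⟩ := hS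
    obtain ⟨k, hk, hfk', hkN⟩ := hN
    rw [hsv j hj (hfj.trans hfi.symm)] at hjS
    rw [hsv k hk (hfk'.trans hfi.symm)] at hkN
    have hne := ω.2.sIn_ne_sOut hi
    revert hjS hkN hne
    cases ω.2.sIn i <;> cases ω.2.sOut i <;> decide
  -- `L` itself is straight: entered from `N`
  have hLin : ω.2.sIn (n - 1) = .N := by
    obtain ⟨j, hj, hfj, hjN⟩ := hLN
    have hsv := hsvabove (n - 1) hn1 (by rw [hL]; simp only; omega) (by rw [hL]; simp only; omega)
    rw [hsv j hj (hfj.trans hL.symm)] at hjN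
    rcases hjN with e | e
    · exact e
    · rw [hsS] at e; exact absurd e (by decide)
  -- climb back from `L`
  have hMt1 : Mt - 1 ≤ n - 1 := by
    by_contra hlt
    push Not at hlt
    have hrb := ω.2.run_back_above_of_straight hn1 le_rfl hLin
      (fun m hm1 hmM i hi hfi => hwall m hm1 (by omega) i hi (by rw [hfi, hL])) (n - 1) le_rfl
    rw [Nat.sub_self, h0w, hL] at hrb
    have := congrArg Prod.fst hrb.1; simp only at this; omega
  have hrb := ω.2.run_back_above_of_straight hn1 hMt1 hLin
    (fun m hm1 hmM i hi hfi => hwall m hm1 (by omega) i hi (by rw [hfi, hL]))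
  refine ⟨fun m hm => ?_, fun m hm => ?_⟩
  · rcases Nat.lt_or_ge m Mt with hlt | hge
    · rcases Nat.eq_zero_or_pos m with e0 | hpos
      · subst e0; simpa using hL
      · obtain ⟨hfm, -⟩ := hrb m (by omega)
        rw [hL] at hfm; rw [hfm]
    · -- `m = Mt`: the top cell, predecessor of the last straight cell
      have hmM : m = Mt := by omega
      subst hmM
      rcases Nat.eq_zero_or_pos m with e0 | hpos
      · omega
      · obtain ⟨hfm, hsm⟩ := hrb (m - 1) (by omega)
        rw [hL] at hfm
        have h1 : 1 ≤ n - 1 - (m - 1) := by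
          by_contra h0; push Not at h0
          have e0 : n - 1 - (m - 1) = 0 := by omega
          rw [e0] at hsm; rw [hsm] at h0W; exact absurd h0W (by decide)
        have hp := ω.2.fc_pred_eq_of_sIn_N (show n - 1 - (m - 1) < n by omega) h1 hsm
        rw [hfm] at hp
        rw [show n - 1 - m = n - 1 - (m - 1) - 1 by omega, hp]
        exact Prod.ext rfl (by simp only; omega)
  · rcases Nat.eq_zero_or_pos m with e0 | hpos
    · subst e0; simpa using hLin
    · exact (hrb m (by omega)).2

/-- ★★★ **HOLE COLUMN BELOW THE HOLE: THE STRAIGHT LEVEL-`7` MEMBER RETURNS FROM BELOW.** Let `ω` be a wound class-`B2a` walk of limit cost `7` from the hole root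
`w.side W` (hole `(w.1 − 1, w.2)` absent) with a slanted end and a STRAIGHT first arc at a rhombus `r` of the hole column (`r.1 = w.1 − 1`) strictly below the hole, some
arc of `ω` lying strictly below the row of `r`. Then `ω.1 = S`, the last plaquette is `(r.1, r.2 − 1)`, left through `N`, and for the walk's bottom row `Y'` the last
`r.2 − Y'` arcs lie at `(r.1, Y'), (r.1, Y' + 1), …, (r.1, r.2 − 1)`, all but the first entered from `S` — the row-mirror [GlazmanManolescu2019, §4.2] of
`descent_of_cost_seven_straight_holeColumn_above`. [cite: GlazmanManolescu2019, §1, Fig. 1 and eq. (1); Lemma 2.1; Remark 2.2; §4.2 (lattice symmetries)]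
[cite: Glazman2015WeightedSAW, Lemma 3.1 (proof, pp. 6–7)] [cite: CourantRobbins1958, Ch. V Appendix §2 (the even–odd rule)] -/
theorem descent_of_cost_seven_straight_holeColumn_below (hh : holeFaceW w ∉ D) (hr : RootedFace D (w.side .W) r) (h : ω.IsB2a)
    (hA : ω.AJ hr h (toC (midPt (w.side .W))) ≠ 0) (hc : cost (slotOfSide ω.1) ω.2.mids = 7) (hz : ω.1 = .N ∨ ω.1 = .S)
    (hstr8 : arcKind (ω.2.sIn ω.2.firstHitG) (ω.2.sOut ω.2.firstHitG) = .straight) (hcol : r.1 = w.1 - 1) (hbelow : r.2 < w.2)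
    (hdown : ∃ j < ω.2.arcs.length, (ω.2.fc j).2 < r.2) :
    ω.1 = .S ∧ ω.2.fc (ω.2.arcs.length - 1) = (r.1, r.2 - 1) ∧ ω.2.sOut (ω.2.arcs.length - 1) = .N ∧
      ∃ Y' : ℤ, (∀ j < ω.2.arcs.length, Y' ≤ (ω.2.fc j).2) ∧ Y' < r.2 ∧
        (∀ m : ℕ, (m : ℤ) ≤ r.2 - Y' - 1 → ω.2.fc (ω.2.arcs.length - 1 - m) = (r.1, r.2 - 1 - m)) ∧
        (∀ m : ℕ, (m : ℤ) < r.2 - Y' - 1 → ω.2.sIn (ω.2.arcs.length - 1 - m) = .S) := by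
  set n := ω.2.arcs.length with hn
  have hF := ω.fh_lt h
  have hn1 : n - 1 < n := by omega
  -- reflect in the root row
  have hh' : holeFaceW w ∉ rowMirrorDom w D := by
    rw [mem_rowMirrorDom]
    have e : mirrorRowFace w.2 (holeFaceW w) = holeFaceW w := by
      simp only [mirrorRowFace, holeFaceW]; exact Prod.ext rfl (by simp only; ring)
    rw [e]; exact hh
  have hr' := rootedFace_rowMirrorDom_mirrorRowFace (w := w) hr
  have h' := isB2a_mirrorAt hr h
  have hA' := AJ_mirrorAt_ne_zero hr h hA
  have hc' : cost (slotOfSide ω.mirrorAt.1) ω.mirrorAt.2.mids = 7 := by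
    show cost (slotOfSide (mirrorSide ω.1)) (ω.2.mids.map (mirrorRow w.2)) = 7
    rw [cost_map_mirrorRow]; exact hc
  have hz' : ω.mirrorAt.1 = .N ∨ ω.mirrorAt.1 = .S := by
    show mirrorSide ω.1 = .N ∨ mirrorSide ω.1 = .S
    rcases hz with e | e <;> rw [e]
    · exact Or.inr rfl
    · exact Or.inl rfl
  have hlen : ω.mirrorAt.2.arcs.length = n := YBWalk.length_arcs_eq_of_mids_mirror ω.mirrorAt_mids
  have hfcm : ∀ i < n, ω.mirrorAt.2.fc i = mirrorRowFace w.2 (ω.2.fc i) := fun i hi => YBWalk.fc_eq_of_mids_mirror ω.mirrorAt_mids hi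
  have hFm : ω.mirrorAt.2.firstHitG = ω.2.firstHitG := YBWalk.firstHitG_eq_of_mids_mirror ω.mirrorAt_mids
  have hstr8' : arcKind (ω.mirrorAt.2.sIn ω.mirrorAt.2.firstHitG) (ω.mirrorAt.2.sOut ω.mirrorAt.2.firstHitG) = .straight := by
    obtain ⟨e1, e2⟩ := YBWalk.sIn_sOut_eq_of_mids_mirror ω.mirrorAt_mids (i := ω.2.firstHitG) hF
    rw [hFm, e1, e2, arcKind_mirrorSide, hstr8]; rfl
  have hcol' : (mirrorRowFace w.2 r).1 = w.1 - 1 := by simp only [mirrorRowFace]; exact hcol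
  have habove' : w.2 < (mirrorRowFace w.2 r).2 := by simp only [mirrorRowFace]; omega
  have hup' : ∃ j < ω.mirrorAt.2.arcs.length, (mirrorRowFace w.2 r).2 < (ω.mirrorAt.2.fc j).2 := by
    obtain ⟨j, hj, hjr⟩ := hdown
    refine ⟨j, by rw [hlen]; exact hj, ?_⟩
    rw [hfcm j hj]; simp only [mirrorRowFace]; omega
  obtain ⟨hN, hL, hS, Y, hY, hrY, hcells, hins⟩ :=
    descent_of_cost_seven_straight_holeColumn_above (ω := ω.mirrorAt) hh' hr' h' hA' hc' hz' hstr8' hcol' habove' hup'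
  rw [hlen] at hL hS hY hcells hins
  have hside : ∀ s : Side, mirrorSide s = .N → s = .S := by intro s; cases s <;> decide
  have hside' : ∀ s : Side, mirrorSide s = .S → s = .N := by intro s; cases s <;> decide
  refine ⟨hside _ hN, ?_, ?_, 2 * w.2 - Y, fun j hj => ?_, ?_, fun m hm => ?_, fun m hm => ?_⟩
  · rw [hfcm _ hn1] at hL
    have e := congrArg (mirrorRowFace w.2) hL
    rw [mirrorRowFace_mirrorRowFace] at e
    rw [e]; simp only [mirrorRowFace]; exact Prod.ext rfl (by simp only; ring)
  · obtain ⟨-, e2⟩ := YBWalk.sIn_sOut_eq_of_mids_mirror ω.mirrorAt_mids (i := n - 1) hn1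
    rw [e2] at hS; exact hside' _ hS
  · have := hY j hj
    rw [hfcm j hj] at this; simp only [mirrorRowFace] at this; omega
  · simp only [mirrorRowFace] at hrY; omega
  · have hm' : (m : ℤ) ≤ Y - (mirrorRowFace w.2 r).2 - 1 := by simp only [mirrorRowFace]; omega
    have e := hcells m hm'
    rw [hfcm _ (by omega)] at e
    have e' := congrArg (mirrorRowFace w.2) e
    rw [mirrorRowFace_mirrorRowFace] at e'
    rw [e']; simp only [mirrorRowFace]; exact Prod.ext rfl (by simp only; ring)
  · have hm' : (m : ℤ) < Y - (mirrorRowFace w.2 r).2 - 1 := by simp only [mirrorRowFace]; omega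
    have e := hins m hm'
    obtain ⟨e1, -⟩ := YBWalk.sIn_sOut_eq_of_mids_mirror ω.mirrorAt_mids (i := n - 1 - m) (by omega)
    rw [e1] at e; exact hside _ e

/-- ★★ **HOLE COLUMN, BOTH SIDES: THE STRAIGHT LEVEL-`7` MEMBER RETURNS FROM THE FAR SIDE.** For a wound class-`B2a` walk of limit cost `7` from the hole root with a
slanted end and a straight first arc at a hole-column rhombus `r` (`r.1 = w.1 − 1`), some arc of the walk lying strictly beyond the row of `r` (above it if `r` is above
the hole, below it if `r` is below), the walk ends by re-entering `r` vertically from the far side: `ω.1 = N` with last plaquette `(r.1, r.2 + 1)` left through `S` if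
`w.2 < r.2`, and `ω.1 = S` with last plaquette `(r.1, r.2 − 1)` left through `N` if `r.2 < w.2`. [cite: GlazmanManolescu2019, §1, Fig. 1 and eq. (1); Lemma 2.1;
Remark 2.2; §4.2] [cite: Glazman2015WeightedSAW, Lemma 3.1 (proof, pp. 6–7)] [cite: CourantRobbins1958, Ch. V Appendix §2 (the even–odd rule)] -/
theorem descent_of_cost_seven_straight_holeColumn (hh : holeFaceW w ∉ D) (hr : RootedFace D (w.side .W) r) (h : ω.IsB2a)
    (hA : ω.AJ hr h (toC (midPt (w.side .W))) ≠ 0) (hc : cost (slotOfSide ω.1) ω.2.mids = 7) (hz : ω.1 = .N ∨ ω.1 = .S)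
    (hstr8 : arcKind (ω.2.sIn ω.2.firstHitG) (ω.2.sOut ω.2.firstHitG) = .straight) (hcol : r.1 = w.1 - 1)
    (hfar : ∃ j < ω.2.arcs.length, (w.2 < r.2 ∧ r.2 < (ω.2.fc j).2) ∨ (r.2 < w.2 ∧ (ω.2.fc j).2 < r.2)) :
    (w.2 < r.2 ∧ ω.1 = .N ∧ ω.2.fc (ω.2.arcs.length - 1) = (r.1, r.2 + 1) ∧ ω.2.sOut (ω.2.arcs.length - 1) = .S) ∨
      (r.2 < w.2 ∧ ω.1 = .S ∧ ω.2.fc (ω.2.arcs.length - 1) = (r.1, r.2 - 1) ∧ ω.2.sOut (ω.2.arcs.length - 1) = .N) := by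
  obtain ⟨j, hj, hj'⟩ := hfar
  rcases hj' with ⟨habove, hjr⟩ | ⟨hbelow, hjr⟩
  · obtain ⟨hN, hL, hS, -⟩ := descent_of_cost_seven_straight_holeColumn_above hh hr h hA hc hz hstr8 hcol habove ⟨j, hj, hjr⟩
    exact Or.inl ⟨habove, hN, hL, hS⟩
  · obtain ⟨hS, hL, hN, -⟩ := descent_of_cost_seven_straight_holeColumn_below hh hr h hA hc hz hstr8 hcol hbelow ⟨j, hj, hjr⟩
    exact Or.inr ⟨hbelow, hS, hL, hN⟩

end ΩG

end Literature.Probability.RandomPlanarGeometry.SAW.YangBaxter
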